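import Literature.MathematicalPhysics.QuantumFieldTheory.Balaban1983to89.B9Eq3105FamThreeLocDiffG
import Literature.MathematicalPhysics.QuantumFieldTheory.Balaban1983to89.B9Eq3105FamThreeTFar
import Literature.MathematicalPhysics.QuantumFieldTheory.Balaban1983to89.B9Thm39CinvSepMiddle

/-!
# `Balaban1983to89.B9Eq3105FamThreeLocDiffGEngine` — FAMILY 3 OF (3.105): THE LOCATED `G′`-DIFFERENCE ENTRY, FILE F3-E2 (the kernel engine) — from the
# one-sided identity of F3-E1, the (3.49)∕(3.42) entries of `G′`, the separation of the located rows from the plateau's edge, and a member-carrier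
# majorant of the commutator letter `K(χ_□)·G′_□`, the entry-1 located difference `∇_μ·M_χl·η²(G′ − G′_□)` has a majorant `ε_D·w(a)·e^{−ρd}` with an
# explicit `ε_D` carrying the two separation factors — the SHAPE of F3-B's displayed `hDL` (letter-free engine on any `B9.Geometry`, plus the real-coordinate
# decomposition on def-Y's site carrier; sub-row G-B9-LETTERS, GAPS G-B9-05∕G-B9-p33-01, programme FAMTHREE FILE F3-E2; design `lit-balaban-p33/g103/F3E-SCOPE.md`)

statement-level skeleton of published theorems with citation tags; proofs where landed; nothing here is a claim about the Yang–Mills mass gap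

THE PRINTED LOCUS (verbatim, held `paper:balaban1985-cmp99-background-propagators`, journal page = PDF page + 388).  p. 415 l.29–31: «Next we replace the
operators G′_{□₀} and C_{□₀} by G′_□, C_□, terms with the differences G′_{□₀} − G′_□ and C_{□₀} − C_□ are small by the same reason as before.»; p. 412
l.22–36: «We have proved in [2] that if we have a difference of propagators defined on two domains, then in an estimate of this difference we have, besides
the usual factors …, an exponential factor with a distance between localizations and a closest point where a change was made», «the operators may differ
outside □̃₀»; (3.88)–(3.89) p. 409; (3.42) p. 397; (3.49) p. 399; [4] (2.51)–(2.55) p. 232, (2.83)–(2.85) pp. 237–238, Lemma 2.1 (2.60)–(2.61) p. 234.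

OURS, NOT PRINT's.  Print's smallness is [2]'s random-walk argument; here the located difference is the SUM of F3-E1's gap piece `M_χl·G′·(1 − M_{χ_□})`
(rows near □, columns off the plateau: the kernel's exponential pays the separation — p38's `rowSep_majorant_blk`) and commutator piece
`M_χl·G′·K(χ_□)·G′_□` (the separated variable in the MIDDLE — `B9Thm39CinvSepMiddle.sepMiddle_majorant_blk`), after the derivative letter has passed the
cut-off by F3-E1's (3.100) identity (`∇_μM_χl = M_{χl(·+e_μ)}∇_μ + M_{η⁻¹δ_μχl}`).

WHAT THIS FILE CERTIFIES (kernel-checked; 0 `def`, 0 `def … : Prop`, 0 sorry; standard axioms only)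

* §1 (any `B9.Geometry g`, carrier `blk : X → g.Site`, letter-free): `hasMajorant_mulOp_left_wt` (a row multiplier bounded block-wise by `F` scales the kernel's row
  by `F(a)`); ★ `hasMajorant_leftFactor` — with `D·M_χl = M_χl′·D + M_dχ` (F3-E1 §2 in coordinates), `D·G ≺ K₁·w(a)·e^{−rd}`, `G ≺ K₀·w₀(a)·e^{−rd}`, `|χl′| ≤ 1` and
  `|dχ| ≤ κ₀` both supported over `S`, `w₀ ≤ ℓ_S·w` on `S`:  `D·M_χl·G ≺ 𝟙_S(a)·((K₁ + κ₀ℓ_SK₀)·w(a)·e^{−rd})`; ★★ `hasMajorant_gapPiece` (`· M_m` with `m`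
  supported over `Z`, `d(S, Z) ≥ D_sep`: `≺ 𝟙_S(a)·((K₁ + κ₀ℓ_SK₀)·e^{−r_sep·D_sep})·w(a)·e^{−r_ρd}`); ★★ `hasMajorant_commPiece` (`· T` with `T = M_{m_Z}·T ≺ θ·e^{−bδ₀d}`,
  `d(S, Z_m) ≥ D′_sep`: `≺ 𝟙_S(a)·(((K₁ + κ₀ℓ_SK₀)·θ·c₁(δ₀, b − ρ))·e^{−a_sep·δ₀·D′_sep})·w(a)·e^{−ρδ₀d}`); ★★★ `hasMajorant_locDiffEntry` (the sum: the
  SHAPE `ε_D·w(a)·e^{−ρδ₀d}` of F3-B's `hDL`, `ε_D` explicit).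
* §2 (def-Y's site carrier, 𝔸-valued): `smul_cutMulY_ofReal`, ★ `conj_diffLetter_mul_cutMulY` (F3-E1 §2 under `conj b`: `conj(∇_μ)·mulOp χl = mulOp χl′·conj(∇_μ) +
  mulOp(η⁻¹δ_μχl)`), ★★ `conj_gradF_cut_locDiff_eq` (from F3-E1's identity `M_χl(O − Ō) = M_χlO(1 − M_χ) + M_χlOKŌ`: `conj(∇_μ)·conj((η²·M_χl(O − Ō))^ℝ) =
  [conj(∇_μ)·mulOp χl·conj((η²O)^ℝ)]·mulOp(1 − χ) + [conj(∇_μ)·mulOp χl·conj((η²O)^ℝ)]·conj((KŌ)^ℝ)` — the two pieces §1 prices).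

HONEST SCOPE ∕ NOT CLAIMED.  This is the ENGINE: `hDL` itself needs, per cube, (i) the member-distance separations `d(S, Z) ≥ D_sep` (rows of `χl(·+e_μ)`∕`δχl`
vs the blocks where `χ_□ ≠ 1`) and `d(S, Z_m) ≥ D′_sep` (vs the rows of `K(χ_□)`) — F3-E2a (p38 g47, `B9Cor36CollarSeparation`, in flight), (ii) a member-carrier
majorant `θ·e^{−bδ₀d}` of `conj((K(χ_□)(V′)·G′_□(V′))^ℝ)` with its rows in `Z_m` — p21 D3∕D4 + `hasMajorant_conj_site_sandwich_src_global` (F3-E2b), (iii) the entries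
of `G′(U₁)` (`B9CubeLettersInvReadDict`) and the geometry inequality `η⁻¹·ℓ(a) ≤ S_j` on `S` (`pow_levY_le_SC`), (iv) F3-E1 §4's identity (`IsUnit Δ′_a(U₁)`,
`IsUnit Δ′_{a,□}(V′)`, the datum) — all DISPLAYED here as hypotheses of the letter-free theorems; the instance is file F3-E2c.  No inequality of [B9]∕[2] is
claimed beyond what the hypotheses give.  Count-neutral; NOT a node discharge; no summit ∕ sub-problem statement is proved; nothing continuum ∕ OS ∕ mass-gap ∕
Clay; YM mass gap NOT proved (Track A conditional rung).  No `sorry`, no `axiom`, no `… : Prop` fact, no `instance`, no `notation`, no `def`.  NEW file; nothing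
landed is modified.  Cell `lit-balaban`, seat `lit-balaban-p33` gen 103, 2026-08-29; `--supports stmt-QuantumFields-19200` as helper.  Net new unproved facts: 0.

RELATED IN THE TREE, NOT DUPLICATED (searched 2026-08-29: `rg 'leftFactor|gapPiece|commPiece|locDiffEntry' Literature/` = ∅): p38 `B9Eq3105FamThreeTFar`
(`rowSep_majorant_blk`, `hasMajorant_rowInd_of_mulOp`), `B9Thm39CinvSepMiddle` (`sepMiddle_majorant_blk`, `hasMajorant_mulOp_rows`), `B9Eq395Small`
(`hasMajorant_mulOp_left`, `hasMajorant_mul_mulOp_right`, `mulOp_mul_mulOp`), F3-E1 `B9Eq3105FamThreeLocDiffG` — all USED BY NAME.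
-/

noncomputable section

namespace Literature.MathematicalPhysics.QuantumFieldTheory.Balaban1983to89.B9Eq3105FamThreeLocDiffGEngine

open NormedSpace Complex
open B6RandomWalk (HasMajorant hasMajorant_mono hasMajorant_add Ineq261 c1_nonneg Triangle254)
open B9Thm34Ext (toB6)
open B9Thm37Sum (mulOp mulOp_apply)
open B9Eq352DivFormLetters (conj)
open B9Eq352GradLetters (diffLetter)
open B9Eq395Small (hasMajorant_mulOp_left hasMajorant_mul_mulOp_right mulOp_mul_mulOp)
open B9Thm39CinvSepMiddle (sepMiddle_majorant_blk hasMajorant_mulOp_rows)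
open B9Thm39CinvTorusRegular (conj_cutMulY)
open B9Eq3105FamThreeTFar (rowSep_majorant_blk hasMajorant_rowInd_of_mulOp)
open B9Eq3105FamThreeLocDiffG (diffLetter_inl_mul_cutMulY)
open B6KLevelCensusIndexV1 (KIdx)
open B9Thm37CubeCoverCommutators (cutMulY cutMulY_apply)
open Node00 (SiteY CfgY shiftY UboxY)

/-! ## §1  The letter-free engine -/

section Generic

variable {g : B9.Geometry} [Fintype g.Site] [DecidableEq g.Site] {Rg : ℝ} {Hg : Prop} {X : Type}

omit [DecidableEq g.Site] in
/-- a row multiplier bounded BLOCK-WISE, `|f(x)| ≤ F(blk x)`, scales the kernel's row: `M_f·T ≺ F(a)·K(a, b′)`.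
[cite: Balaban1984PropagatorsII, (2.51)–(2.52) p.232, bookkeeping] -/
theorem hasMajorant_mulOp_left_wt (blk : X → g.Site) {T : Module.End ℝ (X → ℝ)} {K : g.Site → g.Site → ℝ}
    (hT : HasMajorant (g := toB6 g Rg Hg) blk T K) (f : X → ℝ) (F : g.Site → ℝ) (hf : ∀ x, |f x| ≤ F (blk x)) :
    HasMajorant (g := toB6 g Rg Hg) blk (mulOp f * T) (fun (a b' : g.Site) => F a * K a b') := by
  intro (y' : g.Site) μ B hμ x
  show |(mulOp f * T) μ x| ≤ F (blk x) * K (blk x) y' * B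
  rw [Module.End.mul_apply, mulOp_apply, abs_mul, mul_assoc]
  exact mul_le_mul (hf x) (hT y' μ B hμ x) (abs_nonneg _) ((abs_nonneg _).trans (hf x))

/-- ★ **THE LEFT FACTOR `D·M_χl·G`**: with the (3.100) commutation `D·M_χl = M_χl′·D + M_dχ`, the entry majorants `D·G ≺ K₁·w(a)·e^{−rd}`, `G ≺ K₀·w₀(a)·e^{−rd}`,
`|χl′| ≤ 1` and `|dχ| ≤ κ₀` supported over the row blocks `S`, and `w₀ ≤ ℓ_S·w` on `S`:  `D·M_χl·G ≺ 𝟙_S(a)·((K₁ + κ₀·ℓ_S·K₀)·w(a)·e^{−rd})`.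
[cite: Balaban1985BackgroundPropagators, (3.100) p.413, (3.42) p.397, (3.49) p.399; Balaban1984PropagatorsII, (2.51)–(2.52) p.232] -/
theorem hasMajorant_leftFactor (blk : X → g.Site) {D G : Module.End ℝ (X → ℝ)} (χl χl' dχ : X → ℝ) {K₁ K₀ κ₀ ℓS r : ℝ}
    (w w₀ : g.Site → ℝ) (S : Finset g.Site) (hK₀ : 0 ≤ K₀) (hκ₀ : 0 ≤ κ₀)
    (hcomm : D * mulOp χl = mulOp χl' * D + mulOp dχ)
    (hχ1 : ∀ x, |χl' x| ≤ 1) (hχ0 : ∀ x, blk x ∉ S → χl' x = 0) (hd1 : ∀ x, |dχ x| ≤ κ₀) (hd0 : ∀ x, blk x ∉ S → dχ x = 0)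
    (hℓS : ∀ a ∈ S, w₀ a ≤ ℓS * w a)
    (hDG : HasMajorant (g := toB6 g Rg Hg) blk (D * G) (fun (a b' : g.Site) => K₁ * w a * Real.exp (-(r * g.dist a b'))))
    (hG : HasMajorant (g := toB6 g Rg Hg) blk G (fun (a b' : g.Site) => K₀ * w₀ a * Real.exp (-(r * g.dist a b')))) :
    HasMajorant (g := toB6 g Rg Hg) blk (D * mulOp χl * G)
      (fun (a b' : g.Site) => (if a ∈ S then (1 : ℝ) else 0) * ((K₁ + κ₀ * ℓS * K₀) * w a * Real.exp (-(r * g.dist a b')))) := by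
  classical
  rw [hcomm, add_mul, mul_assoc]
  -- the two summands with their row indicators
  have h1 := hasMajorant_rowInd_of_mulOp (Rg := Rg) (Hg := Hg) blk χl' (hasMajorant_mulOp_left (G := toB6 g Rg Hg) blk hDG χl' hχ1) S hχ0
  have h2' := hasMajorant_mulOp_left_wt (Rg := Rg) (Hg := Hg) blk hG dχ (fun a => if a ∈ S then κ₀ else 0) fun x => by
    by_cases hx : blk x ∈ S
    · rw [if_pos hx]; exact hd1 x
    · rw [if_neg hx, hd0 x hx, abs_zero]
  refine hasMajorant_mono (g := toB6 g Rg Hg) _ (hasMajorant_add (g := toB6 g Rg Hg) blk h1 h2') fun (a b' : g.Site) => ?_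
  have he : 0 ≤ Real.exp (-(r * g.dist a b')) := Real.exp_nonneg _
  by_cases ha : a ∈ S
  · simp only [if_pos ha, one_mul]
    have hℓ := hℓS a ha
    have : κ₀ * (K₀ * w₀ a * Real.exp (-(r * g.dist a b'))) ≤ κ₀ * ℓS * K₀ * w a * Real.exp (-(r * g.dist a b')) := by
      have h3 : K₀ * w₀ a ≤ K₀ * (ℓS * w a) := mul_le_mul_of_nonneg_left hℓ hK₀
      calc κ₀ * (K₀ * w₀ a * Real.exp (-(r * g.dist a b'))) = κ₀ * (K₀ * w₀ a) * Real.exp (-(r * g.dist a b')) := by ring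
        _ ≤ κ₀ * (K₀ * (ℓS * w a)) * Real.exp (-(r * g.dist a b')) :=
            mul_le_mul_of_nonneg_right (mul_le_mul_of_nonneg_left h3 hκ₀) he
        _ = _ := by ring
    nlinarith [this]
  · simp only [if_neg ha, zero_mul]
    exact le_of_eq (by ring)

/-- ★★ **THE GAP PIECE `D·M_χl·G·M_m`**: the trailing multiplier `|m| ≤ 1` is supported over blocks `Z` with `d(S, Z) ≥ D_sep`; the exponential pays the separation
(p38's `rowSep_majorant_blk`): `≺ 𝟙_S(a)·((K₁ + κ₀ℓ_SK₀)·e^{−r_sep·D_sep})·w(a)·e^{−r_ρd}` for `r_sep + r_ρ ≤ r`.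
[cite: Balaban1985BackgroundPropagators, p.412 l.22–36 («an exponential factor with a distance between localizations and a closest point where a change was made»), p.415 l.29–31; Balaban1984PropagatorsII, (2.83)–(2.85) pp.237–238] -/
theorem hasMajorant_gapPiece (blk : X → g.Site) {D G : Module.End ℝ (X → ℝ)} (χl χl' dχ m : X → ℝ) {K₁ K₀ κ₀ ℓS r rsep rρ Dsep : ℝ}
    (w w₀ : g.Site → ℝ) (S Z : Finset g.Site)
    (hK₁ : 0 ≤ K₁) (hK₀ : 0 ≤ K₀) (hκ₀ : 0 ≤ κ₀) (hℓS0 : 0 ≤ ℓS) (hw : ∀ a, 0 ≤ w a) (hrsep : 0 ≤ rsep) (hsplit : rsep + rρ ≤ r)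
    (hdnn : ∀ a y : g.Site, 0 ≤ g.dist a y)
    (hcomm : D * mulOp χl = mulOp χl' * D + mulOp dχ)
    (hχ1 : ∀ x, |χl' x| ≤ 1) (hχ0 : ∀ x, blk x ∉ S → χl' x = 0) (hd1 : ∀ x, |dχ x| ≤ κ₀) (hd0 : ∀ x, blk x ∉ S → dχ x = 0)
    (hℓS : ∀ a ∈ S, w₀ a ≤ ℓS * w a)
    (hm1 : ∀ x, |m x| ≤ 1) (hm0 : ∀ x, m x ≠ 0 → blk x ∈ Z) (hsep : ∀ a ∈ S, ∀ y ∈ Z, Dsep ≤ g.dist a y)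
    (hDG : HasMajorant (g := toB6 g Rg Hg) blk (D * G) (fun (a b' : g.Site) => K₁ * w a * Real.exp (-(r * g.dist a b'))))
    (hG : HasMajorant (g := toB6 g Rg Hg) blk G (fun (a b' : g.Site) => K₀ * w₀ a * Real.exp (-(r * g.dist a b')))) :
    HasMajorant (g := toB6 g Rg Hg) blk (D * mulOp χl * G * mulOp m)
      (fun (a b' : g.Site) => (if a ∈ S then (1 : ℝ) else 0) *
        (((K₁ + κ₀ * ℓS * K₀) * Real.exp (-(rsep * Dsep))) * w a * Real.exp (-(rρ * g.dist a b')))) :=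
  rowSep_majorant_blk (Rg := Rg) (Hg := Hg) blk w S Z m (by positivity) hw hrsep hsplit hdnn hm1 hm0 hsep
    (hasMajorant_leftFactor (Rg := Rg) (Hg := Hg) blk χl χl' dχ w w₀ S hK₀ hκ₀ hcomm hχ1 hχ0 hd1 hd0 hℓS hDG hG)

/-- the row indicator of the left factor as a multiplier: `M_{f_S}·(M_χl′·D·G + M_dχ·G) = M_χl′·D·G + M_dχ·G` for the site indicator `f_S` of `supp χl′ ∪ supp dχ`.
[cite: Balaban1984PropagatorsII, (2.52) p.232, bookkeeping] -/
theorem mulOp_ind_mul_leftFactor {D G : Module.End ℝ (X → ℝ)} (χl χl' dχ : X → ℝ) (hcomm : D * mulOp χl = mulOp χl' * D + mulOp dχ) :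
    mulOp (fun x => if χl' x ≠ 0 ∨ dχ x ≠ 0 then (1 : ℝ) else 0) * (D * mulOp χl * G) = D * mulOp χl * G := by
  classical
  have key : ∀ f : X → ℝ, (∀ x, f x ≠ 0 → (χl' x ≠ 0 ∨ dχ x ≠ 0)) →
      mulOp (fun x => if χl' x ≠ 0 ∨ dχ x ≠ 0 then (1 : ℝ) else 0) * mulOp f = mulOp f := fun f hf => by
    rw [mulOp_mul_mulOp]
    congr 1
    funext x
    by_cases hx : f x = 0
    · rw [hx, mul_zero]
    · rw [if_pos (hf x hx), one_mul]
  rw [hcomm, add_mul, mul_add, mul_assoc (mulOp χl') D G, ← mul_assoc (mulOp _) (mulOp χl') (D * G), key χl' fun x h => Or.inl h, ← mul_assoc (mulOp _) (mulOp dχ) G,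
    key dχ fun x h => Or.inr h]

/-- ★★ **THE COMMUTATOR PIECE `D·M_χl·G·T`**: `T = M_{m_Z}·T` (its rows in the blocks `Z_m`, e.g. the rows of `K(χ_□)·G′_□`) with `T ≺ θ·e^{−bδ₀d}`, the rows `S` of the
left factor at distance `≥ D′_sep` from `Z_m`, the member (2.61) at `b − ρ`, `a_sep + ρ ≤ 1` (fractions of the left factor's rate `δ₀`):
`≺ 𝟙_S(a)·(((K₁ + κ₀ℓ_SK₀)·θ·c₁(δ₀, b − ρ))·e^{−a_sep·δ₀·D′_sep})·w(a)·e^{−ρδ₀d}` (`B9Thm39CinvSepMiddle.sepMiddle_majorant_blk`, separated variable in the middle).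
[cite: Balaban1985BackgroundPropagators, p.412 l.22–36, (3.88)–(3.89) p.409, p.415 l.29–31; Balaban1984PropagatorsII, (2.83)–(2.85) pp.237–238, (2.52)–(2.55) p.232, Lemma 2.1 (2.61) p.234] -/
theorem hasMajorant_commPiece (blk : X → g.Site) (dB : ℕ) {D G T : Module.End ℝ (X → ℝ)} (χl χl' dχ mZ : X → ℝ)
    {K₁ K₀ κ₀ ℓS δ₀ asep ρ b θ Dsep : ℝ} (w w₀ : g.Site → ℝ) (S Z : Finset g.Site)
    (hK₁ : 0 ≤ K₁) (hK₀ : 0 ≤ K₀) (hκ₀ : 0 ≤ κ₀) (hℓS0 : 0 ≤ ℓS) (hθ : 0 ≤ θ) (hw : ∀ a, 0 ≤ w a) (hδ₀ : 0 ≤ δ₀)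
    (hasep : 0 ≤ asep) (hρ : 0 ≤ ρ) (hsplit : asep + ρ ≤ 1)
    (htri : Triangle254 (toB6 g Rg Hg)) (hsymm : ∀ a y : g.Site, g.dist a y = g.dist y a) (hdnn : ∀ a y : g.Site, 0 ≤ g.dist a y)
    (h261 : Ineq261 dB (toB6 g Rg Hg) δ₀ (b - ρ))
    (hcomm : D * mulOp χl = mulOp χl' * D + mulOp dχ)
    (hχ1 : ∀ x, |χl' x| ≤ 1) (hχ0 : ∀ x, blk x ∉ S → χl' x = 0) (hd1 : ∀ x, |dχ x| ≤ κ₀) (hd0 : ∀ x, blk x ∉ S → dχ x = 0)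
    (hℓS : ∀ a ∈ S, w₀ a ≤ ℓS * w a)
    (hm1 : ∀ x, |mZ x| ≤ 1) (hm0 : ∀ x, blk x ∉ Z → mZ x = 0) (hTm : mulOp mZ * T = T) (hsep : ∀ a ∈ S, ∀ y ∈ Z, Dsep ≤ g.dist a y)
    (hDG : HasMajorant (g := toB6 g Rg Hg) blk (D * G) (fun (a b' : g.Site) => K₁ * w a * Real.exp (-(δ₀ * g.dist a b'))))
    (hG : HasMajorant (g := toB6 g Rg Hg) blk G (fun (a b' : g.Site) => K₀ * w₀ a * Real.exp (-(δ₀ * g.dist a b'))))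
    (hT : HasMajorant (g := toB6 g Rg Hg) blk T (fun (y b' : g.Site) => θ * Real.exp (-(b * δ₀ * g.dist y b')))) :
    HasMajorant (g := toB6 g Rg Hg) blk (D * mulOp χl * G * T)
      (fun (a b' : g.Site) => (if a ∈ S then (1 : ℝ) else 0) *
        ((K₁ + κ₀ * ℓS * K₀) * θ * 1 * B6.c1 dB δ₀ (b - ρ) * Real.exp (-(asep * δ₀ * Dsep))) * (w a * 1) * Real.exp (-(ρ * δ₀ * g.dist a b'))) := by
  classical
  have hL := hasMajorant_leftFactor (Rg := Rg) (Hg := Hg) blk χl χl' dχ w w₀ S hK₀ hκ₀ hcomm hχ1 hχ0 hd1 hd0 hℓS hDG hG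
  -- drop the indicator for the `sepMiddle` input, and rewrite the operator as `M_f·L·M_m·T`
  have hL' : HasMajorant (g := toB6 g Rg Hg) blk (D * mulOp χl * G)
      (fun (a y : g.Site) => (K₁ + κ₀ * ℓS * K₀) * w a * Real.exp (-(1 * δ₀ * g.dist a y))) := by
    refine hasMajorant_mono (g := toB6 g Rg Hg) _ hL fun (a y : g.Site) => ?_
    have hwa := hw a
    have h0 : 0 ≤ (K₁ + κ₀ * ℓS * K₀) * w a * Real.exp (-(δ₀ * g.dist a y)) := by positivity
    rw [one_mul]
    by_cases ha : a ∈ S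
    · rw [if_pos ha, one_mul]
    · rw [if_neg ha, zero_mul]; exact h0
  have hop : D * mulOp χl * G * T = mulOp (fun x => if χl' x ≠ 0 ∨ dχ x ≠ 0 then (1 : ℝ) else 0) * (D * mulOp χl * G) * mulOp mZ * T := by
    rw [mulOp_ind_mul_leftFactor χl χl' dχ hcomm, mul_assoc (D * mulOp χl * G) (mulOp mZ) T, hTm]
  rw [hop]
  have hT' : HasMajorant (g := toB6 g Rg Hg) blk T (fun (y b' : g.Site) => θ * 1 * Real.exp (-(b * δ₀ * g.dist y b'))) :=
    hasMajorant_mono (g := toB6 g Rg Hg) _ hT fun y b' => le_of_eq (by rw [mul_one])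
  exact sepMiddle_majorant_blk (R := Rg) (H := Hg) blk dB δ₀ 1 0 asep ρ b (K₁ + κ₀ * ℓS * K₀) θ 1 Dsep w (fun _ => 1) (fun _ => 1) S Z
    (fun x => if χl' x ≠ 0 ∨ dχ x ≠ 0 then (1 : ℝ) else 0) mZ (by positivity) hθ zero_le_one hw (fun _ => zero_le_one) (fun _ => zero_le_one) hδ₀ hasep hρ
    (by linarith) htri hsymm hdnn (fun a y => by simp) h261
    (fun x => by split_ifs <;> simp) (fun x hx => by rw [if_neg (not_or.2 ⟨fun h => h (hχ0 x hx), fun h => h (hd0 x hx)⟩)]) hm1 hm0 hsep hL' hT'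

/-- ★★★ **THE LOCATED `G′`-DIFFERENCE ENTRY, SHAPE OF F3-B's `hDL`**: gap piece + commutator piece:
`D·M_χl·G·M_m + D·M_χl·G·T ≺ ε_D·w(a)·e^{−ρδ₀d}`, `ε_D = (K₁ + κ₀ℓ_SK₀)·(e^{−r_sep·D_sep} + θ·c₁(δ₀, b − ρ)·e^{−a_sep·δ₀·D′_sep})` (row indicator dropped).
[cite: Balaban1985BackgroundPropagators, p.415 l.29–31, p.412 l.22–36, (3.49) p.399; Balaban1983RegularityDecay, (1.11)–(1.12) (statement type); Balaban1984PropagatorsII, (2.83)–(2.85) pp.237–238, Lemma 2.1 (2.61) p.234] -/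
theorem hasMajorant_locDiffEntry (blk : X → g.Site) (dB : ℕ) {D G T : Module.End ℝ (X → ℝ)} (χl χl' dχ m mZ : X → ℝ)
    {K₁ K₀ κ₀ ℓS δ₀ asep ρ b θ Dsep Dsep' : ℝ} (w w₀ : g.Site → ℝ) (S Z Zm : Finset g.Site)
    (hK₁ : 0 ≤ K₁) (hK₀ : 0 ≤ K₀) (hκ₀ : 0 ≤ κ₀) (hℓS0 : 0 ≤ ℓS) (hθ : 0 ≤ θ) (hw : ∀ a, 0 ≤ w a) (hδ₀ : 0 ≤ δ₀)
    (hasep : 0 ≤ asep) (hρ : 0 ≤ ρ) (hsplit : asep + ρ ≤ 1)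
    (htri : Triangle254 (toB6 g Rg Hg)) (hsymm : ∀ a y : g.Site, g.dist a y = g.dist y a) (hdnn : ∀ a y : g.Site, 0 ≤ g.dist a y)
    (h261 : Ineq261 dB (toB6 g Rg Hg) δ₀ (b - ρ))
    (hcomm : D * mulOp χl = mulOp χl' * D + mulOp dχ)
    (hχ1 : ∀ x, |χl' x| ≤ 1) (hχ0 : ∀ x, blk x ∉ S → χl' x = 0) (hd1 : ∀ x, |dχ x| ≤ κ₀) (hd0 : ∀ x, blk x ∉ S → dχ x = 0)
    (hℓS : ∀ a ∈ S, w₀ a ≤ ℓS * w a)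
    (hm1 : ∀ x, |m x| ≤ 1) (hmZ : ∀ x, m x ≠ 0 → blk x ∈ Z) (hsep : ∀ a ∈ S, ∀ y ∈ Z, Dsep ≤ g.dist a y)
    (hmZ1 : ∀ x, |mZ x| ≤ 1) (hmZ0 : ∀ x, blk x ∉ Zm → mZ x = 0) (hTm : mulOp mZ * T = T) (hsep' : ∀ a ∈ S, ∀ y ∈ Zm, Dsep' ≤ g.dist a y)
    (hDG : HasMajorant (g := toB6 g Rg Hg) blk (D * G) (fun (a b' : g.Site) => K₁ * w a * Real.exp (-(δ₀ * g.dist a b'))))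
    (hG : HasMajorant (g := toB6 g Rg Hg) blk G (fun (a b' : g.Site) => K₀ * w₀ a * Real.exp (-(δ₀ * g.dist a b'))))
    (hT : HasMajorant (g := toB6 g Rg Hg) blk T (fun (y b' : g.Site) => θ * Real.exp (-(b * δ₀ * g.dist y b')))) :
    HasMajorant (g := toB6 g Rg Hg) blk (D * mulOp χl * G * mulOp m + D * mulOp χl * G * T)
      (fun (a b' : g.Site) => ((K₁ + κ₀ * ℓS * K₀) * (Real.exp (-(asep * δ₀ * Dsep)) + θ * B6.c1 dB δ₀ (b - ρ) * Real.exp (-(asep * δ₀ * Dsep')))) *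
        w a * Real.exp (-(ρ * δ₀ * g.dist a b'))) := by
  classical
  have hA := hasMajorant_gapPiece (Rg := Rg) (Hg := Hg) blk χl χl' dχ m w w₀ S Z hK₁ hK₀ hκ₀ hℓS0 hw (mul_nonneg hasep hδ₀)
    (show asep * δ₀ + ρ * δ₀ ≤ δ₀ by nlinarith) hdnn hcomm hχ1 hχ0 hd1 hd0 hℓS hm1 hmZ hsep hDG hG
  have hB := hasMajorant_commPiece (Rg := Rg) (Hg := Hg) blk dB χl χl' dχ mZ w w₀ S Zm hK₁ hK₀ hκ₀ hℓS0 hθ hw hδ₀ hasep hρ hsplit htri hsymm hdnn h261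
    hcomm hχ1 hχ0 hd1 hd0 hℓS hmZ1 hmZ0 hTm hsep' hDG hG hT
  refine hasMajorant_mono (g := toB6 g Rg Hg) _ (hasMajorant_add (g := toB6 g Rg Hg) blk hA hB) fun (a b' : g.Site) => ?_
  have hc1 : 0 ≤ B6.c1 dB δ₀ (b - ρ) := c1_nonneg _ _ _
  have h0 : 0 ≤ ((K₁ + κ₀ * ℓS * K₀) * (Real.exp (-(asep * δ₀ * Dsep)) + θ * B6.c1 dB δ₀ (b - ρ) * Real.exp (-(asep * δ₀ * Dsep')))) *
      w a * Real.exp (-(ρ * δ₀ * g.dist a b')) := by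
    have := hw a; positivity
  by_cases ha : a ∈ S
  · simp only [if_pos ha, one_mul, mul_one]
    exact le_of_eq (by ring)
  · simp only [if_neg ha, zero_mul, zero_add]
    exact h0

end Generic

/-! ## §2  The real-coordinate decomposition on def-Y's site carrier -/

section Site

variable {d ℓ : ℕ} {hd : 1 ≤ d + 1} {hL : Odd (ℓ + 1) ∧ 1 < ℓ + 1} {b₀ b₁ : ℝ}
variable {𝔸 : Type} [NormedRing 𝔸] [NormedAlgebra ℂ 𝔸] [CompleteSpace 𝔸]
variable {ι : Type} [Fintype ι]
variable (i : KIdx d ℓ hd hL b₀ b₁) (b : Module.Basis ι ℝ 𝔸)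

omit [CompleteSpace 𝔸] in
/-- a real scalar merges into the cut-off: `(r : ℂ)•M_f = M_{r·f}`. [cite: Balaban1985BackgroundPropagators, (3.100) p.413, bookkeeping] -/
theorem smul_cutMulY_ofReal {S : Type} (r : ℝ) (f : S → ℝ) : ((r : ℂ)) • cutMulY (𝔸 := 𝔸) f = cutMulY (𝔸 := 𝔸) (fun z => r * f z) := by
  refine LinearMap.ext fun Λ => funext fun z => ?_
  simp only [LinearMap.smul_apply, Pi.smul_apply, cutMulY_apply, smul_smul, Complex.ofReal_mul]

/-- ★ **F3-E1 §2 UNDER `conj b`**: `conj(∇_μ)·mulOp χl = mulOp χl(·+e_μ)·conj(∇_μ) + mulOp(η⁻¹(χl(·+e_μ) − χl))` on the real coordinates of the site carrier.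
[cite: Balaban1985BackgroundPropagators, (3.100) p.413, (3.3) p.390; Balaban1984PropagatorsII, (2.51) p.232] -/
theorem conj_diffLetter_mul_cutMulY (U : CfgY 𝔸 i) (η : ℝ) (μ : Fin (d + 1)) (χl : SiteY i → ℝ) :
    conj b (diffLetter (shiftY i) (UboxY i U) ((η : ℂ))⁻¹ (Sum.inl μ)) * mulOp (fun p : SiteY i × ι => χl p.1) =
      mulOp (fun p : SiteY i × ι => χl (shiftY i μ p.1)) * conj b (diffLetter (shiftY i) (UboxY i U) ((η : ℂ))⁻¹ (Sum.inl μ)) +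
        mulOp (fun p : SiteY i × ι => η⁻¹ * (χl (shiftY i μ p.1) - χl p.1)) := by
  rw [← conj_cutMulY b χl, ← B9Eq352DivFormLetters.conj_mul, diffLetter_inl_mul_cutMulY i U _ μ χl, B9Cor36GpCubeEntriesAtV.conj_add',
    B9Eq352DivFormLetters.conj_mul, conj_cutMulY, ← Complex.ofReal_inv, smul_cutMulY_ofReal, conj_cutMulY]

/-- ★★ **THE ENTRY-1 LOCATED DIFFERENCE IN REAL COORDINATES**: from the one-sided identity `M_χl·(O − Ō) = M_χl·O·(1 − M_χ) + M_χl·O·K·Ō` (F3-E1 §3∕§4),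
`conj(∇_μ)·conj((η²·(M_χl ∘ (O − Ō)))^ℝ) = [conj(∇_μ)·mulOp χl·conj((η²O)^ℝ)]·mulOp(1 − χ) + [conj(∇_μ)·mulOp χl·conj((η²O)^ℝ)]·conj((K·Ō)^ℝ)` — the gap piece and the
commutator piece of §1, with `D := conj(∇_μ)`, `G := conj((η²O)^ℝ)`.
[cite: Balaban1985BackgroundPropagators, p.415 l.29–31, (3.97) p.412, (3.88) p.409, (3.49) p.399; Balaban1984PropagatorsII, (2.51) p.232] -/
theorem conj_gradF_cut_locDiff_eq (U : CfgY 𝔸 i) (η : ℝ) (μ : Fin (d + 1)) (χl χ : SiteY i → ℝ) (O Ob Kc : (SiteY i → 𝔸) →ₗ[ℂ] (SiteY i → 𝔸))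
    (hId : cutMulY (𝔸 := 𝔸) χl * (O - Ob) = cutMulY (𝔸 := 𝔸) χl * O * (1 - cutMulY (𝔸 := 𝔸) χ) + cutMulY (𝔸 := 𝔸) χl * O * Kc * Ob) :
    conj b (diffLetter (shiftY i) (UboxY i U) ((η : ℂ))⁻¹ (Sum.inl μ)) * conj b ((((η ^ 2 : ℝ) : ℂ) • (cutMulY (𝔸 := 𝔸) χl ∘ₗ (O - Ob))).restrictScalars ℝ) =
      conj b (diffLetter (shiftY i) (UboxY i U) ((η : ℂ))⁻¹ (Sum.inl μ)) * mulOp (fun p : SiteY i × ι => χl p.1) *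
          conj b ((((η ^ 2 : ℝ) : ℂ) • O).restrictScalars ℝ) * mulOp (fun p : SiteY i × ι => 1 - χ p.1) +
        conj b (diffLetter (shiftY i) (UboxY i U) ((η : ℂ))⁻¹ (Sum.inl μ)) * mulOp (fun p : SiteY i × ι => χl p.1) *
          conj b ((((η ^ 2 : ℝ) : ℂ) • O).restrictScalars ℝ) * conj b ((Kc * Ob).restrictScalars ℝ) := by
  -- `1 − M_χ = M_{1−χ}`
  have hc : (1 - cutMulY (𝔸 := 𝔸) χ : (SiteY i → 𝔸) →ₗ[ℂ] (SiteY i → 𝔸)) = cutMulY (𝔸 := 𝔸) (fun z => 1 - χ z) := by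
    refine LinearMap.ext fun Λ => funext fun z => ?_
    rw [LinearMap.sub_apply, Pi.sub_apply, Module.End.one_apply, cutMulY_apply, cutMulY_apply, Complex.ofReal_sub, Complex.ofReal_one, sub_smul, one_smul]
  -- the word behind `conj b`, as a sum of two products of `ℝ`-linear maps
  have e : ((((η ^ 2 : ℝ) : ℂ) • (cutMulY (𝔸 := 𝔸) χl ∘ₗ (O - Ob))).restrictScalars ℝ : Module.End ℝ (SiteY i → 𝔸)) =
      (cutMulY (𝔸 := 𝔸) χl).restrictScalars ℝ * ((((η ^ 2 : ℝ) : ℂ) • O).restrictScalars ℝ) * (cutMulY (𝔸 := 𝔸) (fun z => 1 - χ z)).restrictScalars ℝ +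
        (cutMulY (𝔸 := 𝔸) χl).restrictScalars ℝ * ((((η ^ 2 : ℝ) : ℂ) • O).restrictScalars ℝ) * (Kc * Ob).restrictScalars ℝ := by
    rw [← hc]
    refine LinearMap.ext fun Λ => ?_
    have h1Λ : cutMulY (𝔸 := 𝔸) χl ((O - Ob) Λ) = cutMulY (𝔸 := 𝔸) χl (O ((1 - cutMulY (𝔸 := 𝔸) χ) Λ)) + cutMulY (𝔸 := 𝔸) χl (O (Kc (Ob Λ))) := by
      have h := congrArg (fun T : (SiteY i → 𝔸) →ₗ[ℂ] (SiteY i → 𝔸) => T Λ) hId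
      simpa only [Module.End.mul_apply, LinearMap.add_apply] using h
    simp only [LinearMap.restrictScalars_apply, LinearMap.smul_apply, LinearMap.add_apply, Module.End.mul_apply, LinearMap.coe_comp, Function.comp_apply,
      h1Λ, smul_add, map_smul]
  rw [e, B9Cor36GpCubeEntriesAtV.conj_add', B9Eq352DivFormLetters.conj_mul, B9Eq352DivFormLetters.conj_mul, B9Eq352DivFormLetters.conj_mul,
    B9Eq352DivFormLetters.conj_mul, conj_cutMulY, conj_cutMulY, mul_add]
  simp only [mul_assoc]

end Site

end Literature.MathematicalPhysics.QuantumFieldTheory.Balaban1983to89.B9Eq3105FamThreeLocDiffGEngine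

end
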